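import Summits.ValiantsHypothesis.ValiantsHypothesis.Theorems.GrenetZeonDualUnipotentThreeHalvesHeavyTopHalfSpeedOneLevel
import Summits.ValiantsHypothesis.ValiantsHypothesis.Theorems.GrenetZeonDualUnipotentThreeHalvesHeavyTopHalfSpeedTwoLevels

/-!
# `GrenetZeon.DualUnipotentThreeHalves` (stmt-ValiantsHypothesis-24318), LINE β `half_speed`, stub K1 — ★ (ii-LOOP) THE CHAIN LOOP:
# gluing certified / killed constituents along a block-triangular chain, heights `Σ h_t + (#levels − 1)`, codimensions added

`exists_halfSpeed_chain`: let `U ≤ M_ι(ℂ)` be block-upper for a level function `lvl : ι → ℕ` with levels `< L + 1`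
(`lvl j < lvl i ⇒ A i j = 0`), and for every level `t` let `Ut t ⊇` the `t`-th diagonal blocks of `U`, `Tt t ≤ Ut t` and a height
`h t` with `HalfSpeed (h t) (Ut t) (Tt t)` — KILL levels take `Tt t = ⊥`, `h t = 0` (✓ `exists_kill_leaf`), CERTIFY levels take the
C⁺ certificate (✓ `exists_certify_leaf`).  Then there is `T ≤ U` with

  `HalfSpeed (Σ_{t ≤ L} h t + L) U T`  and  `finrank U + Σ_{t ≤ L} finrank (Tt t) ≤ finrank T + Σ_{t ≤ L} finrank (Ut t)`.

Induction on `L`: base ✓ `exists_halfSpeed_one_level`; step = peel level `0` with ✓ `halfSpeed_of_two_levels` and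
✓ `exists_seam_submodule_pred`, the lower block `{i // lvl i ≠ 0}` carrying `lvl − 1` and its level subtypes identified with those
of `ι` by explicit equivalences (certificates transported by ✓ `halfSpeed_reindex`, `finrank` by `Submodule.equivMapOfInjective`).
This is desk #332's item (ii-LOOP); with port-2 g2's (ii-ARITH) composite `halfSpeed_allocation` (shape agreed 19:59Z) and the
grouping of ✓ `HeavyTopCompositionBound.exists_block_conj`'s chain, item (iii) `HalfSpeedIrrLaw → HalfSpeedLaw` is an assembly.
Honest framing: the induction of a stub of LINE β; nothing here proves `HalfSpeedLaw`, `HalfSpeedIrrLaw`, `HeavyTopLaw`, 24318, S3b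
or 8062; `VP ≠ VNP` is not moved; no summit statement is proved here.  No definitions, no named facts. [β card K1; val-port-3 g2]
-/

noncomputable section

-- single-conjunct layout: Sub = Summit, duplicated namespace component intended
set_option linter.dupNamespace false

namespace Summit.ValiantsHypothesis.ValiantsHypothesis.Theorems.GrenetZeon.HalfSpeed

open Matrix

universe u

/-- **THE CHAIN LOOP** (induction on the number of levels; tag-free: KILL levels carry `Tt t = ⊥`, `h t = 0`).
Levels `< L + 1`; output height `Σ_{t ≤ L} h t + L`, codimensions add. [β card K1 (ii-LOOP)] -/
theorem exists_halfSpeed_chain (L : ℕ) :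
    ∀ {ι : Type u} [Fintype ι] [DecidableEq ι] (lvl : ι → ℕ) (_hlvl : ∀ i, lvl i < L + 1)
      (U : Submodule ℂ (Matrix ι ι ℂ)) (_hblock : ∀ A ∈ U, ∀ i j, lvl j < lvl i → A i j = 0)
      (Ut Tt : ∀ t : ℕ, Submodule ℂ (Matrix {i // lvl i = t} {i // lvl i = t} ℂ))
      (_hUt : ∀ t, ∀ A ∈ U, A.toBlock (fun i => lvl i = t) (fun i => lvl i = t) ∈ Ut t)
      (_hTU : ∀ t, Tt t ≤ Ut t) (h : ℕ → ℕ)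
      (_hcert : ∀ t, HalfSpeed (h t) (Ut t : Set (Matrix {i // lvl i = t} {i // lvl i = t} ℂ)) (Tt t)),
      ∃ T : Submodule ℂ (Matrix ι ι ℂ), T ≤ U ∧
        HalfSpeed ((Finset.range (L + 1)).sum h + L) (U : Set (Matrix ι ι ℂ)) T ∧
        Module.finrank ℂ U + (Finset.range (L + 1)).sum (fun t => Module.finrank ℂ (Tt t)) ≤
          Module.finrank ℂ T + (Finset.range (L + 1)).sum (fun t => Module.finrank ℂ (Ut t)) := by
  induction L with
  | zero =>
      intro ι _ _ lvl hlvl U hblock Ut Tt hUt hTU h hcert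
      have h0 : ∀ i, lvl i = 0 := fun i => Nat.lt_one_iff.mp (hlvl i)
      let e : {i // lvl i = 0} ≃ ι := Equiv.subtypeUnivEquiv h0
      have hre : ∀ A : Matrix ι ι ℂ, Matrix.reindex e.symm e.symm A = A.toBlock (fun i => lvl i = 0) (fun i => lvl i = 0) := by
        intro A; ext a b; rfl
      obtain ⟨T, hTU', hT, hdim⟩ := exists_halfSpeed_one_level e (h 0) U (Ut 0) (Tt 0)
        (fun A hA => by rw [hre]; exact hUt 0 A hA) (hTU 0) (hcert 0)
      refine ⟨T, hTU', by simpa using hT, by simpa using hdim⟩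
  | succ L ih =>
      intro ι _ _ lvl hlvl U hblock Ut Tt hUt hTU h hcert
      classical
      -- the lower block: indices of positive level, levels shifted down by one
      let p : ι → Prop := fun i => lvl i = 0
      let ι₂ := {i // ¬ p i}
      let lvl₂ : ι₂ → ℕ := fun j => lvl j.1 - 1
      have hlvl₂ : ∀ j : ι₂, lvl₂ j < L + 1 := by
        intro j; have := hlvl j.1; have hj : lvl j.1 ≠ 0 := j.2; simp only [lvl₂]; omega
      -- the block projection onto the lower block, as a linear map
      let b₂ : Matrix ι ι ℂ →ₗ[ℂ] Matrix ι₂ ι₂ ℂ :=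
        { toFun := fun A => A.toBlock (fun i => ¬ p i) (fun i => ¬ p i), map_add' := fun _ _ => rfl,
          map_smul' := fun _ _ => rfl }
      have hb₂ : ∀ A, b₂ A = A.toBlock (fun i => ¬ p i) (fun i => ¬ p i) := fun _ => rfl
      let U₂ : Submodule ℂ (Matrix ι₂ ι₂ ℂ) := U.map b₂
      have hblock₂ : ∀ A ∈ U₂, ∀ i j : ι₂, lvl₂ j < lvl₂ i → A i j = 0 := by
        intro A hA i j hij
        obtain ⟨B, hB, rfl⟩ := Submodule.mem_map.1 hA
        rw [hb₂]
        have hi : lvl i.1 ≠ 0 := i.2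
        have hj : lvl j.1 ≠ 0 := j.2
        exact hblock B hB i.1 j.1 (by simp only [lvl₂] at hij; omega)
      -- level subtypes of the lower block vs. level subtypes of `ι`
      let ε : ∀ t : ℕ, {j : ι₂ // lvl₂ j = t} ≃ {i : ι // lvl i = t + 1} := fun t =>
        { toFun := fun j => ⟨j.1.1, by have h1 := j.2; have h2 : lvl j.1.1 ≠ 0 := j.1.2; simp only [lvl₂] at h1; omega⟩
          invFun := fun i => ⟨⟨i.1, by have := i.2; simp only [p]; omega⟩, by have := i.2; simp only [lvl₂]; omega⟩
          left_inv := fun j => by ext; rfl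
          right_inv := fun i => by ext; rfl }
      let R : ∀ t : ℕ, Matrix {i : ι // lvl i = t + 1} {i : ι // lvl i = t + 1} ℂ ≃ₗ[ℂ]
          Matrix {j : ι₂ // lvl₂ j = t} {j : ι₂ // lvl₂ j = t} ℂ :=
        fun t => Matrix.reindexLinearEquiv ℂ ℂ (ε t).symm (ε t).symm
      have hR : ∀ t X, R t X = Matrix.reindex (ε t).symm (ε t).symm X := fun _ _ => rfl
      let Ut₂ : ∀ t : ℕ, Submodule ℂ (Matrix {j : ι₂ // lvl₂ j = t} {j : ι₂ // lvl₂ j = t} ℂ) :=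
        fun t => (Ut (t + 1)).map (R t).toLinearMap
      let Tt₂ : ∀ t : ℕ, Submodule ℂ (Matrix {j : ι₂ // lvl₂ j = t} {j : ι₂ // lvl₂ j = t} ℂ) :=
        fun t => (Tt (t + 1)).map (R t).toLinearMap
      have hblk : ∀ (t : ℕ) (B : Matrix ι ι ℂ),
          (b₂ B).toBlock (fun j => lvl₂ j = t) (fun j => lvl₂ j = t) =
            R t (B.toBlock (fun i => lvl i = t + 1) (fun i => lvl i = t + 1)) := by
        intro t B; ext a c; rfl
      have hUt₂ : ∀ t, ∀ A ∈ U₂, A.toBlock (fun j => lvl₂ j = t) (fun j => lvl₂ j = t) ∈ Ut₂ t := by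
        intro t A hA
        obtain ⟨B, hB, rfl⟩ := Submodule.mem_map.1 hA
        rw [hblk]
        exact Submodule.mem_map.2 ⟨_, hUt (t + 1) B hB, rfl⟩
      have hTU₂ : ∀ t, Tt₂ t ≤ Ut₂ t := fun t => Submodule.map_mono (hTU (t + 1))
      have hcert₂ : ∀ t, HalfSpeed (h (t + 1))
          (Ut₂ t : Set (Matrix {j : ι₂ // lvl₂ j = t} {j : ι₂ // lvl₂ j = t} ℂ)) (Tt₂ t) := by
        intro t
        have := halfSpeed_reindex (ε t).symm (h (t + 1)) _ _ (hcert (t + 1))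
        convert this using 1 <;> simp only [Ut₂, Tt₂, Submodule.map_coe] <;> rfl
      -- induction hypothesis on the lower block
      obtain ⟨T₂, hT₂U, hT₂, hdim₂⟩ := ih lvl₂ hlvl₂ U₂ hblock₂ Ut₂ Tt₂ hUt₂ hTU₂ (fun t => h (t + 1)) hcert₂
      -- glue level 0 on top of the lower block
      obtain ⟨T, hTU', hmem, hdim⟩ := exists_seam_submodule_pred p U (Ut 0) (Tt 0) U₂ T₂ (hUt 0)
        (fun A hA => Submodule.mem_map.2 ⟨A, hA, rfl⟩) (hTU 0) hT₂U
      have hprof : HalfSpeed (h 0 + ((Finset.range (L + 1)).sum (fun t => h (t + 1)) + L) + 1)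
          (U : Set (Matrix ι ι ℂ)) T := by
        refine halfSpeed_of_two_levels p _ _ (U : Set (Matrix ι ι ℂ)) T (Ut 0 : Set _) (Tt 0) (U₂ : Set _) T₂
          ?_ ?_ (hcert 0) hT₂
        · intro A hA
          refine ⟨fun i j hi hj => hblock A hA i j ?_, hUt 0 A hA, Submodule.mem_map.2 ⟨A, hA, rfl⟩⟩
          have : lvl j = 0 := hj; have : lvl i ≠ 0 := hi; omega
        · intro A hA
          obtain ⟨hAU, h1, h2⟩ := (hmem A).1 hA
          refine ⟨fun i j hi hj => hblock A hAU i j ?_, h1, h2⟩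
          have : lvl j = 0 := hj; have : lvl i ≠ 0 := hi; omega
      -- finrank of the transported certificates
      have hfinU : ∀ t, Module.finrank ℂ (Ut₂ t) = Module.finrank ℂ (Ut (t + 1)) := fun t =>
        (LinearEquiv.finrank_eq (Submodule.equivMapOfInjective _ (R t).injective _)).symm
      have hfinT : ∀ t, Module.finrank ℂ (Tt₂ t) = Module.finrank ℂ (Tt (t + 1)) := fun t =>
        (LinearEquiv.finrank_eq (Submodule.equivMapOfInjective _ (R t).injective _)).symm
      simp only [hfinU, hfinT] at hdim₂
      have hdim₂' : Module.finrank ℂ U₂ + (Finset.range (L + 1)).sum (fun t => Module.finrank ℂ (Tt (t + 1))) ≤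
          Module.finrank ℂ T₂ + (Finset.range (L + 1)).sum (fun t => Module.finrank ℂ (Ut (t + 1))) := hdim₂
      have hdim' : Module.finrank ℂ U + Module.finrank ℂ (Tt 0) + Module.finrank ℂ T₂ ≤
          Module.finrank ℂ T + Module.finrank ℂ (Ut 0) + Module.finrank ℂ U₂ := hdim
      refine ⟨T, hTU', ?_, ?_⟩
      · refine halfSpeed_mono (le_of_eq ?_) hprof
        rw [Finset.sum_range_succ' h (L + 1)]
        ring
      · rw [Finset.sum_range_succ' (fun t => Module.finrank ℂ (Tt t)) (L + 1),
          Finset.sum_range_succ' (fun t => Module.finrank ℂ (Ut t)) (L + 1)]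
        clear hdim hdim₂
        omega

end Summit.ValiantsHypothesis.ValiantsHypothesis.Theorems.GrenetZeon.HalfSpeed

end
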